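import Literature.AlgebraicGeometry.Frobenioids.PerfectionFunctorialityComplements
import Literature.AlgebraicGeometry.Frobenioids.PerfectionIsotropic
import Literature.AlgebraicGeometry.Frobenioids.PerfectionEquivalence
import Literature.AlgebraicGeometry.Frobenioids.IsotropicFrobenioid
import Literature.AlgebraicGeometry.Frobenioids.IstrStandardTypeProofs
import Literature.AlgebraicGeometry.Frobenioids.UnitTrivializationIsFrobenioid
import Literature.AlgebraicGeometry.Frobenioids.PreFrobenioidDataToFunctor
import HarnessLib

/-!
# [FrdI] Prop. 5.5 (ii), first clause: the comparison functor `(C^pf)^un-tr → (C^un-tr)^pf`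

[cite: MochizukiFrdI2008, Prop. 5.5 (ii) p.104]

Mochizuki, *The geometry of Frobenioids I*, Prop. 5.5 (ii) (p. 104; proof p. 105 ll. 1–8): "a natural
equivalence of categories [compatible with the functors to the respective elementary Frobenioids] between
`(C^pf)^un-tr` and `(C^un-tr)^pf`", for `C` of Frobenius-isotropic type; print: "we may assume without loss of
generality that `C` is of isotropic type … it suffices to obtain natural bijections between the respective
sets of morphisms between the images of two given objects of `C` … this follows immediately from the
definitions, together with Proposition 3.2, (ii), applied to 'pre-steps' and 'units'".

Against THE perfection `PreFrobenioid.Perfection hF` (abc-iut-L1-d9) and THE unit-trivialisation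
`(PreFrobenioidData.ofFunctor Φ F).Untr` (a quotient category; abc-iut-L1-t3/L1-d5) the tree has no
"WLOG isotropic", so this file routes print's argument through the perfection `(C^istr)^pf` of the Frobenioid
`C^istr` (Prop. 1.9 (v), `isFrobenioid_istr`):
* (§1 = `PerfectionFunctorialityComplements.lean`: `G^pf` is full / faithful when `G` is, preserves degrees,
  lies over the base when `G` does; units of `C^pf` are classes of units at a diagonal level);
* (§2) the inclusion `ι : C^istr → C` and `j : C^istr → C^un-tr` are Frobenius-compatible, whence
  `I := ι^pf : (C^istr)^pf → C^pf` (full, faithful, lying over `D`; essentially surjective for `C` of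
  Frobenius-isotropic type, via `(A, n) ≅ (A^{(d)}, n·d)`) and `U := j^pf : (C^istr)^pf → (C^un-tr)^pf`
  (full, lying over `D`);
* (§3) `U` kills the `I`-preimages of units of `C^pf`, so `X ↦ U(P_X)`, `u ↦ U(I⁻¹(c_X ≫ u ≫ c_Y⁻¹))`
  (`P_X` an `I`-preimage of `X`, `c_X : I P_X ≅ X`) is a functor `(C^pf)^istr → (C^un-tr)^pf` constant on
  unit-equivalence classes, which descends to THE comparison functor
  `PerfectionUntr.comparison : (C^pf)^un-tr → (C^un-tr)^pf`, lying over `D` (`comparisonCompBaseIso`, from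
  "`I`, `U` lie over `D`").
That it is an equivalence (the hom-set bijections) is `PerfectionUntrCommuteEquiv.lean`.
DISCLOSURE: the printed hypothesis "Frobenius-normalized type" is not used for (ii) (print uses it in (i));
"Frobenius-isotropic type" is used (essential surjectivity of `I`, isotropy of the objects of `C^pf`).
-/

namespace Literature.AlgebraicGeometry.Frobenioids

namespace PreFrobenioid

open CategoryTheory Opposite

/-! ### §2 The functors `I = ι^pf : (C^istr)^pf → C^pf` and `U = j^pf : (C^istr)^pf → (C^un-tr)^pf` -/

universe w v v' u u'

variable {D : Type u} [Category.{v} D] {Φ : Dᵒᵖ ⥤ CommMonCat.{w}}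
  {C : Type u'} [Category.{v'} C] {F : C ⥤ ElemFrobenioid Φ}

open PreFrobenioidData (ofFunctor)

variable (F) in
/-- The functor `j : C^istr → C^un-tr` (found's `C^istr`, re-typed over `ofFunctor Φ F`, followed by the quotient
functor `C^istr → C^un-tr` of Def. 3.1 (iv)). [cite: MochizukiFrdI2008, Def. 3.1 (iv) p.57] -/
noncomputable def istrToUntr : Istr F ⥤ (ofFunctor Φ F).Untr :=
  ObjectProperty.ιOfLE (isotropicObjects_le_ofFunctor F) ⋙ (ofFunctor Φ F).toUntr

/-- `j` on objects. [cite: MochizukiFrdI2008, Def. 3.1 (iv) p.57] -/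
theorem istrToUntr_obj (A : Istr F) :
    (istrToUntr F).obj A = (ofFunctor Φ F).toUntr.obj ⟨A.obj, isotropicObjects_le_ofFunctor F _ A.property⟩ :=
  rfl

/-- `j` on arrows. [cite: MochizukiFrdI2008, Def. 3.1 (iv) p.57] -/
theorem istrToUntr_map {A B : Istr F} (f : A ⟶ B) :
    (istrToUntr F).map f = (ofFunctor Φ F).toUntr.map
      (ObjectProperty.homMk f.hom : (⟨A.obj, isotropicObjects_le_ofFunctor F _ A.property⟩ : (ofFunctor Φ F).Istr) ⟶
        ⟨B.obj, isotropicObjects_le_ofFunctor F _ B.property⟩) :=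
  rfl

/-- **The inclusion `ι : C^istr → C` is Frobenius-compatible** (Prop. 1.9 (v): an arrow of `C^istr` is of
Frobenius type iff it is so in `C`; same degree). [cite: MochizukiFrdI2008, Prop. 1.9 (v) p.32] -/
theorem isFrobeniusCompatible_istrι (hF : IsFrobenioid F) :
    IsFrobeniusCompatible (istrFunctor F) F (isotropicObjects F).ι where
  isFrobeniusType_map _ _ f hf := (isFrobeniusType_istr_iff hF f).mp hf
  degFr_map _ _ _ _ := rfl

/-- **`j : C^istr → C^un-tr` is Frobenius-compatible** for the Frobenioid structure `untrFunctor hF` of `C^un-tr`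
(Prop. 3.3 (iv): a class is of Frobenius type iff a representative is; same degree).
[cite: MochizukiFrdI2008, Prop. 3.3 (iv) p.60] -/
theorem isFrobeniusCompatible_istrToUntr (hF : IsFrobenioid F) :
    IsFrobeniusCompatible (istrFunctor F) (untrFunctor hF) (istrToUntr F) where
  isFrobeniusType_map _ _ f hf :=
    (isFrobeniusType_toUntr_iff hF _).mpr ((isFrobeniusType_istr_iff hF f).mp hf)
  degFr_map _ _ _ _ := rfl

namespace PerfectionUntr

variable (hF : IsFrobenioid F)

/-- `I = ι^pf : (C^istr)^pf → C^pf`, `(A, n) ↦ (A, n)` (Thm. 3.4 (iii) functoriality of the perfection along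
`C^istr ↪ C`). [cite: MochizukiFrdI2008, Prop. 5.5 (ii) p.104] -/
noncomputable def inclMap : Perfection (isFrobenioid_istr hF) ⥤ Perfection hF :=
  Perfection.map (hF₁ := isFrobenioid_istr hF) (hF₂ := hF) (isFrobeniusCompatible_istrι hF)

/-- `U = j^pf : (C^istr)^pf → (C^un-tr)^pf`, `(A, n) ↦ ([A], n)` (Thm. 3.4 (iii) functoriality along
`C^istr → C^un-tr`). [cite: MochizukiFrdI2008, Prop. 5.5 (ii) p.104] -/
noncomputable def untrMap : Perfection (isFrobenioid_istr hF) ⥤ Perfection (isFrobenioid_untr hF) :=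
  Perfection.map (hF₁ := isFrobenioid_istr hF) (hF₂ := isFrobenioid_untr hF) (isFrobeniusCompatible_istrToUntr hF)

variable {hF}

/-- `I` on objects. [cite: MochizukiFrdI2008, Prop. 5.5 (ii) p.104] -/
theorem inclMap_obj (P : Perfection (isFrobenioid_istr hF)) : (inclMap hF).obj P = ⟨P.obj.obj, P.idx⟩ := rfl

/-- `U` on objects. [cite: MochizukiFrdI2008, Prop. 5.5 (ii) p.104] -/
theorem untrMap_obj (P : Perfection (isFrobenioid_istr hF)) :
    (untrMap hF).obj P = ⟨(istrToUntr F).obj P.obj, P.idx⟩ := rfl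

/-- `I` is faithful. [cite: MochizukiFrdI2008, Prop. 5.5 (ii) p.105] -/
theorem inclMap_faithful : (inclMap hF).Faithful :=
  Perfection.map_faithful_of_faithful (hF₁ := isFrobenioid_istr hF) (hF₂ := hF) (isFrobeniusCompatible_istrι hF)

/-- `I` is full. [cite: MochizukiFrdI2008, Prop. 5.5 (ii) p.105] -/
theorem inclMap_full : (inclMap hF).Full :=
  Perfection.map_full_of_full (hF₁ := isFrobenioid_istr hF) (hF₂ := hF) (isFrobeniusCompatible_istrι hF)

/-- `j : C^istr → C^un-tr` is full (the quotient functor is). [cite: MochizukiFrdI2008, Prop. 3.3 (iii) p.59] -/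
theorem _root_.Literature.AlgebraicGeometry.Frobenioids.PreFrobenioid.istrToUntr_full :
    (istrToUntr F).Full := by
  unfold istrToUntr; infer_instance

/-- `U` is full (`C^istr → C^un-tr` is full). [cite: MochizukiFrdI2008, Prop. 5.5 (ii) p.105] -/
theorem untrMap_full : (untrMap hF).Full :=
  haveI := istrToUntr_full (F := F)
  Perfection.map_full_of_full (hF₁ := isFrobenioid_istr hF) (hF₂ := isFrobenioid_untr hF)
    (isFrobeniusCompatible_istrToUntr hF)

/-- **`I` is essentially surjective for `C` of Frobenius-isotropic type**: `(A, n) ≅ (A^{(d)}, n·d)` with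
`A^{(d)}` isotropic, `d` the degree of a Frobenius-type arrow from `A` to an isotropic object (Def. 1.3 (ii),
(vii)(b); the class at level `(1, d)` of the isomorphism `(A^{(d)})^{(1)} ≅ A^{(d)}`) — print's "WLOG isotropic".
[cite: MochizukiFrdI2008, Prop. 5.5 (ii) p.105] -/
theorem inclMap_essSurj (hiso : IsOfType (IsFrobeniusIsotropic F)) : (inclMap hF).EssSurj := by
  refine ⟨fun Y => ?_⟩
  obtain ⟨A', φ, hφ, hA'⟩ := hiso Y.obj
  let d : ℕ+ := PreFrobenioid.degFr F φ
  have hd : IsIsotropic F (frobPow hF Y.obj d) := Perfection.isIsotropic_frobPow hF hφ hA' dvd_rfl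
  let P : Perfection (isFrobenioid_istr hF) := ⟨⟨frobPow hF Y.obj d, hd⟩, Y.idx * d⟩
  haveI := Perfection.isIso_frob_one (hF := hF) (frobPow hF Y.obj d)
  let X : Perfection hF := ⟨frobPow hF Y.obj d, Y.idx * d⟩
  have hX : (inclMap hF).obj P = X := rfl
  let r : Perfection.Rep X Y :=
    ⟨⟨1, d, by change Y.idx * d * 1 = Y.idx * d; rw [mul_one]⟩, inv (frob hF (frobPow hF Y.obj d) 1)⟩
  haveI : IsIso (X := X) (Y := Y) (Perfection.Hom.mk r) :=
    Perfection.isIso_mk_of_isIso r (by change IsIso (inv (frob hF (frobPow hF Y.obj d) 1)); infer_instance)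
  exact ⟨P, ⟨hX ▸ asIso (Perfection.Hom.mk r : X ⟶ Y)⟩⟩

/-- `I` preserves Frobenius degrees. [cite: MochizukiFrdI2008, Prop. 5.5 (ii) p.104] -/
theorem degFr_inclMap_map {P Q : Perfection (isFrobenioid_istr hF)} (f : P ⟶ Q) :
    (Perfection.ops hF).degFr ((inclMap hF).map f) = (Perfection.ops (isFrobenioid_istr hF)).degFr f :=
  Perfection.degFr_map_map (hF₁ := isFrobenioid_istr hF) (hF₂ := hF) (isFrobeniusCompatible_istrι hF)
    (fun _ _ _ => rfl) f

/-- `U` preserves Frobenius degrees. [cite: MochizukiFrdI2008, Prop. 5.5 (ii) p.104] -/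
theorem degFr_untrMap_map {P Q : Perfection (isFrobenioid_istr hF)} (f : P ⟶ Q) :
    (Perfection.ops (isFrobenioid_untr hF)).degFr ((untrMap hF).map f) =
      (Perfection.ops (isFrobenioid_istr hF)).degFr f :=
  Perfection.degFr_map_map (hF₁ := isFrobenioid_istr hF) (hF₂ := isFrobenioid_untr hF)
    (isFrobeniusCompatible_istrToUntr hF) (fun _ _ _ => rfl) f

/-- **`I` lies over `D`**: `Base(I f) = Base(f)`. [cite: MochizukiFrdI2008, Prop. 5.5 (ii) p.104] -/
theorem base_map_inclMap_map {P Q : Perfection (isFrobenioid_istr hF)} (f : P ⟶ Q) :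
    (Perfection.ops hF).base.map ((inclMap hF).map f) = (Perfection.ops (isFrobenioid_istr hF)).base.map f := by
  obtain ⟨r, rfl⟩ := Perfection.Hom.mk_surjective f
  change (Perfection.repMap (hF₁ := isFrobenioid_istr hF) (hF₂ := hF) (isFrobeniusCompatible_istrι hF) r).baseMap =
    r.baseMap
  haveI : IsIso (Base F (frob (isFrobenioid_istr hF) Q.obj r.L.b).hom) :=
    (isBaseIso_istr_iff _).mp (isIso_base_frob (isFrobenioid_istr hF) Q.obj r.L.b)
  refine (cancel_mono (Base F (frob (isFrobenioid_istr hF) Q.obj r.L.b).hom)).mp ?_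
  have e₁ := Perfection.baseMap_repMap_comp (hF₁ := isFrobenioid_istr hF) (hF₂ := hF)
    (isFrobeniusCompatible_istrι hF) r
  have e₂ : r.baseMap ≫ Base (istrFunctor F) (frob (isFrobenioid_istr hF) Q.obj r.L.b) =
      Base (istrFunctor F) (frob (isFrobenioid_istr hF) P.obj r.L.a) ≫ Base (istrFunctor F) r.hom := by
    unfold Perfection.Rep.baseMap
    simp only [Category.assoc, baseInvFrob_base_frob, Category.comp_id]
  exact e₁.trans e₂.symm

/-- **`U` lies over `D`**: `Base(U f) = Base(f)`. [cite: MochizukiFrdI2008, Prop. 5.5 (ii) p.104] -/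
theorem base_map_untrMap_map {P Q : Perfection (isFrobenioid_istr hF)} (f : P ⟶ Q) :
    (Perfection.ops (isFrobenioid_untr hF)).base.map ((untrMap hF).map f) =
      (Perfection.ops (isFrobenioid_istr hF)).base.map f := by
  obtain ⟨r, rfl⟩ := Perfection.Hom.mk_surjective f
  change (Perfection.repMap (hF₁ := isFrobenioid_istr hF) (hF₂ := isFrobenioid_untr hF)
      (isFrobeniusCompatible_istrToUntr hF) r).baseMap = r.baseMap
  haveI : IsIso (Base (untrFunctor hF) ((istrToUntr F).map (frob (isFrobenioid_istr hF) Q.obj r.L.b))) :=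
    ((isFrobeniusCompatible_istrToUntr hF).isFrobeniusType_map _
      (isFrobeniusType_frob (isFrobenioid_istr hF) Q.obj r.L.b)).2
  refine (cancel_mono (Base (untrFunctor hF) ((istrToUntr F).map (frob (isFrobenioid_istr hF) Q.obj r.L.b)))).mp ?_
  have e₁ := Perfection.baseMap_repMap_comp (hF₁ := isFrobenioid_istr hF) (hF₂ := isFrobenioid_untr hF)
    (isFrobeniusCompatible_istrToUntr hF) r
  have e₂ : r.baseMap ≫ Base (istrFunctor F) (frob (isFrobenioid_istr hF) Q.obj r.L.b) =
      Base (istrFunctor F) (frob (isFrobenioid_istr hF) P.obj r.L.a) ≫ Base (istrFunctor F) r.hom := by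
    unfold Perfection.Rep.baseMap
    simp only [Category.assoc, baseInvFrob_base_frob, Category.comp_id]
  exact e₁.trans e₂.symm

/-! ### §3 `U` kills the `I`-preimages of units; the comparison functor -/

/-- **`U` kills units** ("Prop. 3.2 (ii) applied to units"): an automorphism `θ` of `P` in `(C^istr)^pf` whose
image `I θ` is a unit of `C^pf` (base-identity, linear) is the class of a unit `ϑ ∈ O^×(A^{(c)})` at a diagonal
level; `ϑ` and `id` have the same image in `F_Φ`, so `j ϑ = id` (Prop. 3.3 (ii)) and `U θ = [j ϑ] = id`.
[cite: MochizukiFrdI2008, Prop. 5.5 (ii) p.105] -/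
theorem untrMap_map_eq_id_of_unit {P : Perfection (isFrobenioid_istr hF)} (θ : P ⟶ P) [IsIso θ]
    (hb : (Perfection.ops hF).IsBaseIdentity ((inclMap hF).map θ))
    (hl : (Perfection.ops hF).IsLinear ((inclMap hF).map θ)) : (untrMap hF).map θ = 𝟙 _ := by
  have hb' : (Perfection.ops (isFrobenioid_istr hF)).IsBaseIdentity θ := by
    change (Perfection.ops (isFrobenioid_istr hF)).base.map θ = 𝟙 _
    rw [← base_map_inclMap_map]
    exact hb
  have hl' : (Perfection.ops (isFrobenioid_istr hF)).IsLinear θ := by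
    change (Perfection.ops (isFrobenioid_istr hF)).degFr θ = 1
    rw [← degFr_inclMap_map]
    exact hl
  obtain ⟨c, ϑ, rfl, hϑiso, hϑb, hϑl⟩ := Perfection.exists_endClass_eq_of_unit θ hb' hl'
  -- `j ϑ = id`: same image in `F_Φ` (Prop. 3.3 (ii))
  haveI : IsIso ϑ.hom := (isIso_istr_iff ϑ).mp hϑiso
  have hj : (istrToUntr F).map ϑ = 𝟙 _ := by
    change (ofFunctor Φ F).toUntr.map _ = (ofFunctor Φ F).toUntr.map (𝟙 _)
    refine (toUntr_map_eq_iff hF _ _).mpr (ElemFrobenioid.Hom.ext ?_ ?_ ?_)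
    · exact hϑb.trans (base_id F _).symm
    · exact (isIsometry_of_isIso F hF.isPreFrobenioid ϑ.hom).trans (div_id F _).symm
    · exact hϑl.trans (degFr_id F _).symm
  -- hence `U[ϑ] = [j ϑ conjugated] = [id] = id`
  have e : Perfection.repMap (hF₁ := isFrobenioid_istr hF) (hF₂ := isFrobenioid_untr hF)
      (isFrobeniusCompatible_istrToUntr hF) ⟨Perfection.Level.diag P c, ϑ⟩ =
      (⟨Perfection.Level.diag ((untrMap hF).obj P) c, 𝟙 _⟩ :
        Perfection.Rep ((untrMap hF).obj P) ((untrMap hF).obj P)) := by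
    unfold Perfection.repMap
    dsimp only
    rw [hj, Category.id_comp, Iso.inv_hom_id]
    rfl
  rw [Perfection.endClass_def]
  unfold untrMap
  rw [Perfection.map_mk, e]
  exact Perfection.endClass_id ((untrMap hF).obj P) c

section Comparison

variable (hF) (hiso : IsOfType (IsFrobeniusIsotropic F))

/-- A chosen `I`-preimage `P_X` of an object `X` of `C^pf` (for `C` of Frobenius-isotropic type).
[cite: MochizukiFrdI2008, Prop. 5.5 (ii) p.105] -/
noncomputable def pre (X : Perfection hF) : Perfection (isFrobenioid_istr hF) :=
  haveI := inclMap_essSurj (hF := hF) hiso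
  (inclMap hF).objPreimage X

/-- The chosen isomorphism `c_X : I P_X ≅ X`. [cite: MochizukiFrdI2008, Prop. 5.5 (ii) p.105] -/
noncomputable def preIso (X : Perfection hF) : (inclMap hF).obj (pre hF hiso X) ≅ X :=
  haveI := inclMap_essSurj (hF := hF) hiso
  (inclMap hF).objObjPreimageIso X

/-- The transported arrow `I⁻¹(c_X ≫ u ≫ c_Y⁻¹) : P_X → P_Y` of `(C^istr)^pf` of an arrow `u : X → Y` of `C^pf`
(`I` is fully faithful). [cite: MochizukiFrdI2008, Prop. 5.5 (ii) p.105] -/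
noncomputable def preHom {X Y : Perfection hF} (u : X ⟶ Y) : pre hF hiso X ⟶ pre hF hiso Y :=
  haveI := inclMap_full (hF := hF)
  (inclMap hF).preimage ((preIso hF hiso X).hom ≫ u ≫ (preIso hF hiso Y).inv)

variable {hF hiso}

/-- `I (preHom u) = c_X ≫ u ≫ c_Y⁻¹`. [cite: MochizukiFrdI2008, Prop. 5.5 (ii) p.105] -/
theorem inclMap_map_preHom {X Y : Perfection hF} (u : X ⟶ Y) :
    (inclMap hF).map (preHom hF hiso u) = (preIso hF hiso X).hom ≫ u ≫ (preIso hF hiso Y).inv :=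
  haveI := inclMap_full (hF := hF)
  (inclMap hF).map_preimage _

/-- `preHom` is functorial: identities. [cite: MochizukiFrdI2008, Prop. 5.5 (ii) p.105] -/
theorem preHom_id (X : Perfection hF) : preHom hF hiso (𝟙 X) = 𝟙 _ := by
  haveI := inclMap_faithful (hF := hF)
  apply (inclMap hF).map_injective
  rw [inclMap_map_preHom, Category.id_comp, Iso.hom_inv_id, (inclMap hF).map_id]

/-- `preHom` is functorial: composition. [cite: MochizukiFrdI2008, Prop. 5.5 (ii) p.105] -/
theorem preHom_comp {X Y Z : Perfection hF} (u : X ⟶ Y) (u' : Y ⟶ Z) :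
    preHom hF hiso (u ≫ u') = preHom hF hiso u ≫ preHom hF hiso u' := by
  haveI := inclMap_faithful (hF := hF)
  apply (inclMap hF).map_injective
  simp only [(inclMap hF).map_comp, inclMap_map_preHom, Category.assoc, Iso.inv_hom_id_assoc]

variable (hF hiso) in
/-- The functor `(C^pf)^istr → (C^un-tr)^pf`, `X ↦ U(P_X)`, `u ↦ U(I⁻¹(c_X ≫ u ≫ c_Y⁻¹))`, BEFORE passing to
unit-equivalence classes. [cite: MochizukiFrdI2008, Prop. 5.5 (ii) p.105] -/
noncomputable def comparison₀ : (Perfection.ops hF).Istr ⥤ Perfection (isFrobenioid_untr hF) where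
  obj X := (untrMap hF).obj (pre hF hiso X.obj)
  map u := (untrMap hF).map (preHom hF hiso u.hom)
  map_id X := by
    change (untrMap hF).map (preHom hF hiso (𝟙 X.obj)) = _
    rw [preHom_id, (untrMap hF).map_id]
  map_comp u u' := by
    change (untrMap hF).map (preHom hF hiso (u.hom ≫ u'.hom)) = _
    rw [preHom_comp, (untrMap hF).map_comp]

/-- `comparison₀` on arrows. [cite: MochizukiFrdI2008, Prop. 5.5 (ii) p.105] -/
theorem comparison₀_map {X Y : (Perfection.ops hF).Istr} (u : X ⟶ Y) :
    (comparison₀ hF hiso).map u = (untrMap hF).map (preHom hF hiso u.hom) := rfl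

/-- **`comparison₀` is constant on unit-equivalence classes**: if `u₁ = γ ≫ β` and `u₂ = γ ≫ δ ≫ β` with `δ`
a unit of `C^pf`, then `I⁻¹(c δ c⁻¹)` is an automorphism whose `I`-image is a unit, killed by `U`.
[cite: MochizukiFrdI2008, Prop. 5.5 (ii) p.105] -/
theorem comparison₀_map_eq_of_unitEquiv {X Y : (Perfection.ops hF).Istr} (u₁ u₂ : X ⟶ Y)
    (h : (Perfection.ops hF).UnitEquiv u₁ u₂) :
    (comparison₀ hF hiso).map u₁ = (comparison₀ hF hiso).map u₂ := by
  obtain ⟨Z, γ, β, δ, hδ, rfl, rfl⟩ := h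
  simp only [(comparison₀ hF hiso).map_comp]
  suffices hδ' : (comparison₀ hF hiso).map (ObjectProperty.homMk δ.hom : Z ⟶ Z) = 𝟙 _ by
    rw [hδ', Category.id_comp]
  change (untrMap hF).map (preHom hF hiso δ.hom) = 𝟙 _
  haveI := inclMap_full (hF := hF)
  haveI := inclMap_faithful (hF := hF)
  haveI : IsIso ((inclMap hF).map (preHom hF hiso δ.hom)) := by
    rw [inclMap_map_preHom]; infer_instance
  haveI : IsIso (preHom hF hiso δ.hom) := isIso_of_fully_faithful (inclMap hF) _
  obtain ⟨hb, hl⟩ := Perfection.conj_unit_isBaseIdentity_isLinear (preIso hF hiso Z.obj) δ hδ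
  refine untrMap_map_eq_id_of_unit _ ?_ ?_
  · rw [inclMap_map_preHom]; exact hb
  · rw [inclMap_map_preHom]; exact hl

variable (hF hiso) in
/-- **THE comparison functor `(C^pf)^un-tr → (C^un-tr)^pf`** of [FrdI] Prop. 5.5 (ii): `comparison₀` passed to
the quotient `(C^pf)^un-tr` of `(C^pf)^istr` by unit-equivalence (Def. 3.1 (iv)).
[cite: MochizukiFrdI2008, Prop. 5.5 (ii) p.104] -/
noncomputable def comparison : (Perfection.ops hF).Untr ⥤ Perfection (isFrobenioid_untr hF) :=
  CategoryTheory.Quotient.lift _ (comparison₀ hF hiso)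
    (fun _ _ u₁ u₂ h => comparison₀_map_eq_of_unitEquiv u₁ u₂ h)

/-- `(C^pf)^istr → (C^pf)^un-tr → (C^un-tr)^pf` is `comparison₀` (on the nose).
[cite: MochizukiFrdI2008, Prop. 5.5 (ii) p.104] -/
theorem toUntr_comp_comparison :
    (Perfection.ops hF).toUntr ⋙ comparison hF hiso = comparison₀ hF hiso :=
  CategoryTheory.Quotient.lift_spec _ _ _

/-- The comparison functor on objects. [cite: MochizukiFrdI2008, Prop. 5.5 (ii) p.104] -/
theorem comparison_obj (X : (Perfection.ops hF).Untr) :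
    (comparison hF hiso).obj X = (untrMap hF).obj (pre hF hiso X.as.obj) := rfl

/-- The comparison functor on the class of an arrow. [cite: MochizukiFrdI2008, Prop. 5.5 (ii) p.104] -/
theorem comparison_map_toUntr {X Y : (Perfection.ops hF).Istr} (u : X ⟶ Y) :
    (comparison hF hiso).map ((Perfection.ops hF).toUntr.map u) = (untrMap hF).map (preHom hF hiso u.hom) :=
  rfl

/-! ### Compatibility with the functors to the base -/

variable (hF hiso) in
/-- **The comparison functor lies over `D`**: `comparison ⋙ Base_{(C^un-tr)^pf} ≅ Base_{(C^pf)^un-tr}`, the latter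
being the base functor of the structure functor `untrFunctor hPf` of `(C^pf)^un-tr` (which needs `C^pf` to be a
Frobenioid, Prop. 3.2 (iii), hypothesis `hPf`); components `Base(c_X)`, naturality from "`I`, `U` lie over `D`".
[cite: MochizukiFrdI2008, Prop. 5.5 (ii) p.104] -/
noncomputable def comparisonCompBaseIso (hPf : IsFrobenioid (Perfection.ops hF).toFunctor) :
    comparison hF hiso ⋙ (Perfection.ops (isFrobenioid_untr hF)).base ≅
      (PreFrobenioidData.ofFunctor _ (untrFunctor hPf)).base :=
  CategoryTheory.Quotient.natIsoLift _ (NatIso.ofComponents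
    (fun X => (Perfection.ops hF).base.mapIso (preIso hF hiso X.obj))
    (fun {X Y} u => by
      have h₁ := base_map_untrMap_map (hF := hF) (preHom hF hiso u.hom)
      have h₂ := base_map_inclMap_map (hF := hF) (preHom hF hiso u.hom)
      rw [inclMap_map_preHom] at h₂
      have key := (Perfection.ops hF).base.congr_map
        (show ((preIso hF hiso X.obj).hom ≫ u.hom ≫ (preIso hF hiso Y.obj).inv) ≫ (preIso hF hiso Y.obj).hom =
            (preIso hF hiso X.obj).hom ≫ u.hom by
          simp only [Category.assoc, Iso.inv_hom_id, Category.comp_id])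
      rw [Functor.map_comp, (Perfection.ops hF).base.map_comp (preIso hF hiso X.obj).hom u.hom,
        ← h₁.trans h₂.symm] at key
      exact key))

end Comparison

end PerfectionUntr

end PreFrobenioid

end Literature.AlgebraicGeometry.Frobenioids
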